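import Literature.MathematicalPhysics.QuantumLattice.ClusterPairBosonCouplings
import Literature.MathematicalPhysics.QuantumLattice.HubbardRingPerronFrobeniusProofs
import Literature.MathematicalPhysics.QuantumLattice.PairCorrelations
import HarnessLib

/-!
# The `O(t'²)` pair-boson couplings of the checkerboard Hubbard model (plaquette data)

Definition request `plaquettePairCouplings` (route PolyaSchurPairBoson of HubbardSuperconductivity,
crux DressAnyFilling and its layer-2 child KineticGlueInWindow). The checkerboard Hubbard model
(Tsai–Kivelson 2006; Yao–Tsai–Kivelson 2007, eq. (1)) consists of `2 × 2` plaquettes with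
intra-plaquette hopping `t = 1` and on-site `U`, glued by the hopping `t'` on the two
nearest-neighbour bonds joining adjacent plaquettes. For `t' ≪ 1`, `0 < x < 1/2` and
`O(√t') < U < U_c − O(t')` the low-energy manifold has every plaquette in its `0`-hole
(4-electron) or `2`-hole (2-electron) ground state, and second-order degenerate perturbation theory
in `t'` gives the hard-core boson model of Yao–Tsai–Kivelson 2007, eq. (2),
`H⁽¹⁾ = −t⁽¹⁾ Σ_{⟨RR'⟩} (b†_R b_{R'} + h.c.) + V⁽¹⁾ Σ_{⟨RR'⟩} ρ_R ρ_{R'}`, `t⁽¹⁾, V⁽¹⁾ = O(t'²)`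
(boson = hole pair; `b_R` transforms as `d_{x²−y²}` because the `0`-hole state is `d`-wave and
the `2`-hole state `s`-wave). This file defines these couplings as real numbers computed from the
EXACT finite-dimensional one-plaquette data (no limits), reusing the second-order inter-cluster
kernel `interClusterKernel` of `ClusterPairBosonCouplings` (Kato's reduced resolvent; the
Jordan–Wigner sign between the two plaquettes built in):

* `PlaquetteSite = FermionTorus 2 2`, `plaquetteGraph = fermionTorusGraph 2 2` — at side `L = 2` the
  torus graph is the SIMPLE 4-cycle (the two directions `±eᵢ` coincide, see `torusGraph`), i.e.
  exactly the open `2 × 2` plaquette `C₄` with each bond once; `plaquetteHamiltonian U =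
  hamiltonian plaquetteGraph 1 U = hubbardTorus 2 2 1 U`.
* `plaquetteEnergy U Q = E(Q)`, the ground-state energy with `Q` holes (`4 − Q` electrons); the
  pair binding `plaquettePairBinding U = 2E(1) − E(0) − E(2)` (Tsai–Kivelson 2006, eq. (2):
  positive = binding, for `U < U_c ≈ 4.58`; it is `−Δ` of Yao–Tsai–Kivelson 2007 and `−Δ_b` of
  Altman–Auerbach 2002, §II.D) and the pair exclusion `E(0) + E(4) − 2E(2)`.
* `plaquetteVacuum U`, `plaquettePair U`: normalised ground states of `plaquetteHamiltonian U` in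
  the sectors `(N, S^z) = (4, 0)` (no hole) and `(2, 0)` (one hole pair), obtained by choice from
  `szSector_groundState` and gauge-fixed so that the `d`-wave overlap
  `c(U) = ⟨plaquettePair U, Δ_d^{plaq} plaquetteVacuum U⟩` is real `≥ 0`
  (`plaquetteDWavePair` = the pair field `pairField dWaveFormFactor` restricted to the bonds of one
  plaquette; Altman–Auerbach 2002 §II.D: `b†` creates a pair with internal `d`-wave symmetry w.r.t.
  the vacuum). For `U > 0` both sector ground states are nondegenerate (Tsai–Kivelson 2006,
  Table I; Yao–Tsai–Kivelson 2007, p. 2), so all numbers below are then choice-independent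
  (`J`, `V`, `μ` are invariant under rephasing the two states; this is NOT proved here).
* `plaquetteKernel U κ' κ`, `κ = (n_R, n_{R'}) ∈ Fin 2 × Fin 2` (numbers of hole pairs on the two
  plaquettes `R`, `R' = R + 2e₁`): the `4 × 4` matrix of `T (E − H₀)⁻¹_red T` on the two-plaquette
  manifold, `T` the inter-plaquette hopping at `t' = 1` on the two boundary bonds
  `plaquetteBonds`, `H₀` the decoupled pair of plaquettes, `E = E(a) + E(b)` the energy of the
  product state (`pairEnergy_plaquetteStates`): Tsai–Kivelson 2006, App. A (A1).
* `plaquettePairCouplings U : PlaquettePairCouplings` bundles `E`, the pair binding and exclusion,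
  `J(U) = −Re K((1,0),(0,1))` (pair hopping, `H_eff ∋ −J (b†_R b_{R'} + h.c.)`, `= t⁽¹⁾`),
  `V(U) = Re [K(1,1) + K(0,0) − K(1,0) − K(0,1)]` (n.n. pair–pair interaction `= V⁽¹⁾`; expand the
  diagonal shifts `δE(n,n')` in `n, n' ∈ {0,1}`), `μ(U) = Re [K(1,0) − K(0,0)]` (the `O(t'²)`
  one-body shift per superlattice bond), `c(U) ≥ 0`, and `ΔEff = −V/(2J)`, the anisotropy of the
  equivalent `S = ½` XXZ model `xxzHamiltonian 1 G (−1) Δ` (hopping `½`, repulsion `−Δ` in units of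
  `2J t'²`); Yao–Tsai–Kivelson 2007, p. 4: `V⁽¹⁾/t⁽¹⁾ = 2` exactly at `U_s ≈ 2.7` and `U_c`.

NOT here: the identification of `interClusterKernel` with `secondOrderEffective` of the 8-site
two-plaquette cluster on `Fock (Orb PlaquetteSite ⊕ₗ Orb PlaquetteSite)` (deferred in
`ClusterPairBosonCouplings` as well); nondegeneracy / `d`- and `s`-wave symmetry of the plaquette
ground states (B1g selection rule `c(U) ≠ 0`); any numerical value (`V/2J = 0.986, 0.993` at
`U = 1, 2` are uncertified ED numbers of the route, to be certified by interval arithmetic).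

Tree search: `interClusterKernel`, `bondHopping`, `pairResolvent` (ClusterPairBosonCouplings);
`hamiltonian`, `groundEnergyAt`, `szSector`, `IsGroundStateInSector`, `FermionTorus`,
`fermionTorusGraph` (HubbardModel); `szSector_groundState`, `groundEnergyAt_eq_minEnergyOn_szSector`
(HubbardRingPerronFrobeniusProofs); `exists_smul_unit` (SectorSpectrum); `dWaveFormFactor`,
`localPair`, `pairField` (PairCorrelations); `LiebThm1.hamiltonian_isHermitian`. Mathlib has no
Hubbard clusters or effective Hamiltonians.

References: H. Yao, W.-F. Tsai, S. A. Kivelson, PRB 76 (2007) 161104(R) = arXiv:0706.0761, eqs.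
(1)–(2), p. 4 [YaoTsaiKivelson2007]; W.-F. Tsai, S. A. Kivelson, PRB 73 (2006) 214510 =
cond-mat/0601113, eq. (2), Table I, App. A (A1) [TsaiKivelson2006]; E. Altman, A. Auerbach, PRB 65
(2002) 104508, §II.D [AltmanAuerbach2002]; T. Kato (1966), II-§2.2 [Kato1966].
-/

noncomputable section

namespace Literature.MathematicalPhysics.QuantumLattice

open Matrix Finset Literature.Probability.LatticeModels
open scoped ComplexOrder

/-! ### The plaquette and its Hubbard Hamiltonian -/

/-- The vertex (site) set of the `2 × 2` plaquette, `{0,1}²` with the lexicographic order needed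
by the Jordan–Wigner construction: literally `FermionTorus 2 2 = Lex (Fin 2 → Fin 2)` (coordinate
`0` is `x`, coordinate `1` is `y`; not to be confused with the gauge-theory plaquettes
`QuantumFieldTheory.Plaquette d L`). Yao–Tsai–Kivelson 2007, Fig. 1.
[cite: YaoTsaiKivelson2007, Fig. 1] -/
abbrev PlaquetteSite : Type := FermionTorus 2 2

/-- The plaquette graph `C₄` (the four `t = 1` bonds of an elementary square): the torus graph of
side `2`, which is the SIMPLE nearest-neighbour 4-cycle because `+eᵢ = −eᵢ (mod 2)` (see
`torusGraph`; `plaquetteGraph_adj_iff`). Yao–Tsai–Kivelson 2007, Fig. 1.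
[cite: YaoTsaiKivelson2007, Fig. 1] -/
abbrev plaquetteGraph : SimpleGraph PlaquetteSite := fermionTorusGraph 2 2

/-- Two plaquette sites are adjacent iff they differ in exactly one coordinate (the 4-cycle
`(0,0) ∼ (1,0) ∼ (1,1) ∼ (0,1) ∼ (0,0)`, no diagonals). [folklore] -/
theorem plaquetteGraph_adj_iff (x y : PlaquetteSite) :
    plaquetteGraph.Adj x y ↔
      (ofLex x 0 = ofLex y 0 ∧ ofLex x 1 ≠ ofLex y 1) ∨
        (ofLex x 0 ≠ ofLex y 0 ∧ ofLex x 1 = ofLex y 1) := by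
  revert x y
  decide

/-- The Hubbard Hamiltonian of one plaquette,
`−Σ_{⟨rr'⟩σ} (c†_{rσ} c_{r'σ} + h.c.) + U Σ_r n_{r↑} n_{r↓}` (`t = 1`; equal to
`hubbardTorus 2 2 1 U`). It differs from eq. (1) of Yao–Tsai–Kivelson 2007
(`U/2 Σ (n_r − 1)²`) by a multiple of `N` and a constant, which drop out of every quantity below.
[cite: YaoTsaiKivelson2007, eq. (1)] -/
def plaquetteHamiltonian (U : ℝ) :
    Matrix (Finset (Orb PlaquetteSite)) (Finset (Orb PlaquetteSite)) ℂ :=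
  hamiltonian plaquetteGraph 1 U

/-- `plaquetteHamiltonian U` is the Hubbard torus of side `2` at `t = 1` (definitional).
[folklore] -/
theorem plaquetteHamiltonian_eq_hubbardTorus (U : ℝ) :
    plaquetteHamiltonian U = hubbardTorus 2 2 1 U := rfl

/-- The plaquette Hamiltonian is Hermitian. [folklore] -/
theorem plaquetteHamiltonian_isHermitian (U : ℝ) : (plaquetteHamiltonian U).IsHermitian :=
  LiebThm1.hamiltonian_isHermitian plaquetteGraph 1 U

/-- The plaquette has four sites. [folklore] -/
theorem card_plaquetteSite : Fintype.card PlaquetteSite = 4 := by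
  simp [Fintype.card_lex]

/-! ### Sector energies, pair binding, pair exclusion -/

/-- `E(Q)`: the ground-state energy of the plaquette Hubbard Hamiltonian (`t = 1`) with `Q` doped
holes, i.e. in the `(4 − Q)`-electron sector (`Q = 0,…,4`; for `Q > 4` truncated subtraction gives
the junk value `E(4) = 0`). Tsai–Kivelson 2006, §I (`E(Q)`), Table I; Yao–Tsai–Kivelson 2007, p. 2
(`E₀(Q_h)`). [cite: TsaiKivelson2006, Table I] -/
def plaquetteEnergy (U : ℝ) (Q : ℕ) : ℝ := groundEnergyAt plaquetteGraph 1 U (4 - Q)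

/-- The **pair binding energy** `Δ_p(U) = 2E(1) − E(2) − E(0)` of the plaquette: positive iff two
doped holes prefer to sit on one plaquette rather than on two (`Δ_p > 0` for `0 < U < U_c ≈ 4.58`,
Tsai–Kivelson 2006, eq. (2) and Fig. 5; this is `−Δ` of Yao–Tsai–Kivelson 2007, p. 2 and `−Δ_b` of
Altman–Auerbach 2002, §II.D). [cite: TsaiKivelson2006, eq. (2)] -/
def plaquettePairBinding (U : ℝ) : ℝ :=
  2 * plaquetteEnergy U 1 - plaquetteEnergy U 0 - plaquetteEnergy U 2

/-- The **pair exclusion energy** `E(0) + E(4) − 2E(2)`: the cost of putting two hole pairs on one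
plaquette (the empty plaquette, `E(4) = 0`) and none on another, relative to one pair on each —
the hard-core constraint of the boson model, Yao–Tsai–Kivelson 2007, eq. (2) ("implicit
no-double-occupancy constraint"). [cite: YaoTsaiKivelson2007, eq. (2)] -/
def plaquettePairExclusion (U : ℝ) : ℝ :=
  plaquetteEnergy U 0 + plaquetteEnergy U 4 - 2 * plaquetteEnergy U 2

/-! ### The plaquette `d`-wave pair operator -/

/-- The lattice step `y − x ∈ ℤ²` between two plaquette sites (coordinates read in `ℕ`, no
wrap-around). [folklore] -/
def PlaquetteSite.step (x y : PlaquetteSite) : Site 2 :=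
  fun i => ((ofLex y i : ℕ) : ℤ) - ((ofLex x i : ℕ) : ℤ)

/-- The step along an `x`-bond of the plaquette is `e₁`, on which the `d_{x²−y²}` form factor is
`+1`. [folklore] -/
theorem dWaveFormFactor_step_xBond :
    dWaveFormFactor (PlaquetteSite.step (toLex ![0, 0]) (toLex ![1, 0])) = 1 := by
  have h : PlaquetteSite.step (toLex ![0, 0]) (toLex ![1, 0]) = Pi.single 0 1 := by decide
  rw [h, dWaveFormFactor, if_pos (Or.inl rfl)]

/-- The step along a `y`-bond of the plaquette is `e₂`, on which the `d_{x²−y²}` form factor is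
`−1`. [folklore] -/
theorem dWaveFormFactor_step_yBond :
    dWaveFormFactor (PlaquetteSite.step (toLex ![0, 0]) (toLex ![0, 1])) = -1 := by
  have h : PlaquetteSite.step (toLex ![0, 0]) (toLex ![0, 1]) = Pi.single 1 1 := by decide
  rw [h, dWaveFormFactor, if_neg (by decide), if_pos (Or.inl rfl)]

/-- The **plaquette `d_{x²−y²}` pair annihilation operator**
`Δ_d^{(R)} = Σ_{x,y ∈ R} (g(y − x)/√2) (c_{x↑} c_{y↓} − c_{x↓} c_{y↑})`, `g = dWaveFormFactor`
(`+1` on the two `x`-bonds, `−1` on the two `y`-bonds, `0` on diagonals and for `x = y`): the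
torus pair field `pairField dWaveFormFactor L = Σ_x localPair …` restricted to the ordered nearest-
neighbour pairs inside one plaquette (each bond twice, once per orientation, as in `pairField`).
Up to normalisation and an overall sign this is the operator `Σ d_{ij} c_{i↑} c_{j↓}` whose action
on the 4-electron vacuum produces the hole-pair state, Altman–Auerbach 2002, §II.D; Scalapino,
Phys. Rep. 250 (1995) 329, eq. (2.2)–(2.3). [cite: AltmanAuerbach2002, §II.D] -/
def plaquetteDWavePair : Matrix (Finset (Orb PlaquetteSite)) (Finset (Orb PlaquetteSite)) ℂ :=
  ∑ x : PlaquetteSite, ∑ y : PlaquetteSite,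
    ((dWaveFormFactor (PlaquetteSite.step x y) / Real.sqrt 2 : ℝ) : ℂ) •
      (annihilation (orb x 0) * annihilation (orb y 1) -
        annihilation (orb x 1) * annihilation (orb y 0))

/-! ### The two plaquette ground states and the gauge -/

/-- Normalised ground states of the plaquette exist in the sectors `(N, S^z) = (2n, 0)`, `n ≤ 2`
(`H` is Hermitian and block-diagonal in `(N↑, N↓)`: `szSector_groundState`, then normalise).
Tasaki (2020) §2.2; Lieb, PRL 62 (1989) 1201, proof of Thm 1. [folklore] -/
theorem exists_unit_isGroundStateInSector_plaquette (U : ℝ) {n : ℕ} (hn : n ≤ 2) :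
    ∃ ψ : Fock (Orb PlaquetteSite), star ψ ⬝ᵥ ψ = 1 ∧
      IsGroundStateInSector (plaquetteHamiltonian U) (2 * n) 0 ψ := by
  have hcard : n ≤ Fintype.card PlaquetteSite := by rw [card_plaquetteSite]; omega
  obtain ⟨⟨φ, hφ⟩, -⟩ :
      (∃ ψ, IsGroundStateInSector (plaquetteHamiltonian U) (2 * n) 0 ψ) ∧
        ∀ φ : Fock (Orb PlaquetteSite), IsInSector n n φ →
          (plaquetteHamiltonian U).minEnergyOn (szSector (2 * n) 0) * (star φ ⬝ᵥ φ).re ≤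
            (expect (plaquetteHamiltonian U) φ).re :=
    szSector_groundState plaquetteGraph 1 U hcard
  obtain ⟨c, hc0, hc1⟩ := exists_smul_unit hφ.2.1
  exact ⟨c • φ, hc1, Submodule.smul_mem _ c hφ.1, smul_ne_zero hc0 hφ.2.1,
    by rw [mulVec_smul, hφ.2.2, smul_comm]⟩

/-- **The `0`-hole plaquette state** `|0h⟩`: a chosen normalised ground state of
`plaquetteHamiltonian U` in the sector `(N, S^z) = (4, 0)` (half filling). For `U > 0` it is unique
up to a phase, a spin singlet of `d`-wave (`B₁g`) symmetry (Tsai–Kivelson 2006, Table I, `Ψ₁₁₁`;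
Yao–Tsai–Kivelson 2007, p. 2); the phase is immaterial below. [cite: TsaiKivelson2006, Table I] -/
def plaquetteVacuum (U : ℝ) : Fock (Orb PlaquetteSite) :=
  (exists_unit_isGroundStateInSector_plaquette U (n := 2) le_rfl).choose

/-- `plaquetteVacuum U` is a normalised ground state of the `(4, 0)` sector. [folklore] -/
theorem plaquetteVacuum_spec (U : ℝ) :
    star (plaquetteVacuum U) ⬝ᵥ plaquetteVacuum U = 1 ∧
      IsGroundStateInSector (plaquetteHamiltonian U) 4 0 (plaquetteVacuum U) :=
  (exists_unit_isGroundStateInSector_plaquette U (n := 2) le_rfl).choose_spec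

/-- A chosen normalised ground state of the `(2, 0)` sector, before gauge fixing. [folklore] -/
def plaquettePairRaw (U : ℝ) : Fock (Orb PlaquetteSite) :=
  (exists_unit_isGroundStateInSector_plaquette U (n := 1) one_le_two).choose

/-- `plaquettePairRaw U` is a normalised ground state of the `(2, 0)` sector. [folklore] -/
theorem plaquettePairRaw_spec (U : ℝ) :
    star (plaquettePairRaw U) ⬝ᵥ plaquettePairRaw U = 1 ∧
      IsGroundStateInSector (plaquetteHamiltonian U) 2 0 (plaquettePairRaw U) :=
  (exists_unit_isGroundStateInSector_plaquette U (n := 1) one_le_two).choose_spec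

/-- The unit complex number `z/‖z‖` (and `1` for `z = 0`): multiplying a state by it rotates a
prescribed amplitude `z` onto the nonnegative real axis (`star_alignPhase_mul`). [folklore] -/
def alignPhase (z : ℂ) : ℂ := if z = 0 then 1 else ((‖z‖ : ℝ) : ℂ)⁻¹ * z

/-- `alignPhase z` has modulus one. [folklore] -/
theorem norm_alignPhase (z : ℂ) : ‖alignPhase z‖ = 1 := by
  unfold alignPhase
  split_ifs with hz
  · simp
  · rw [norm_mul, norm_inv, Complex.norm_real, Real.norm_of_nonneg (norm_nonneg z),
      inv_mul_cancel₀ (norm_ne_zero_iff.2 hz)]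

/-- `alignPhase z ≠ 0`. [folklore] -/
theorem alignPhase_ne_zero (z : ℂ) : alignPhase z ≠ 0 :=
  norm_ne_zero_iff.1 (by rw [norm_alignPhase]; exact one_ne_zero)

/-- `conj (alignPhase z) · z = ‖z‖`. [folklore] -/
theorem star_alignPhase_mul (z : ℂ) : star (alignPhase z) * z = ((‖z‖ : ℝ) : ℂ) := by
  unfold alignPhase
  split_ifs with hz
  · simp [hz]
  · rw [star_mul', star_inv₀, Complex.star_def, Complex.conj_ofReal, mul_assoc, Complex.conj_mul',
      sq, ← mul_assoc, inv_mul_cancel₀ (by exact_mod_cast norm_ne_zero_iff.2 hz), one_mul]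

/-- `conj (alignPhase z) · alignPhase z = 1`. [folklore] -/
theorem star_alignPhase_mul_self (z : ℂ) : star (alignPhase z) * alignPhase z = 1 := by
  rw [Complex.star_def, Complex.conj_mul', norm_alignPhase]; simp

/-- **The `2`-hole plaquette state** `|2h⟩` (one hole pair = one boson): the chosen normalised
ground state of the `(N, S^z) = (2, 0)` sector, rephased so that its `d`-wave overlap with
`|0h⟩`, `⟨2h| Δ_d^{(R)} |0h⟩`, is real and nonnegative (`plaquetteDWaveOverlap_eq`). For every `U`
it is unique up to the (now fixed) phase, a spin singlet of `s`-wave symmetry (Tsai–Kivelson 2006,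
Table I, `Ψ₂₂₆`; Yao–Tsai–Kivelson 2007, p. 2), so that the boson `b_R : |2h⟩ ↦ |0h⟩` transforms
as `d_{x²−y²}`. [cite: TsaiKivelson2006, Table I] -/
def plaquettePair (U : ℝ) : Fock (Orb PlaquetteSite) :=
  alignPhase (star (plaquettePairRaw U) ⬝ᵥ (plaquetteDWavePair *ᵥ plaquetteVacuum U)) •
    plaquettePairRaw U

/-- `plaquettePair U` is a normalised ground state of the `(2, 0)` sector. [folklore] -/
theorem plaquettePair_spec (U : ℝ) :
    star (plaquettePair U) ⬝ᵥ plaquettePair U = 1 ∧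
      IsGroundStateInSector (plaquetteHamiltonian U) 2 0 (plaquettePair U) := by
  obtain ⟨h1, hK, h0, hH⟩ := plaquettePairRaw_spec U
  set p := alignPhase (star (plaquettePairRaw U) ⬝ᵥ (plaquetteDWavePair *ᵥ plaquetteVacuum U))
  refine ⟨?_, Submodule.smul_mem _ p hK, smul_ne_zero (alignPhase_ne_zero _) h0, ?_⟩
  · rw [plaquettePair, star_smul, smul_dotProduct, dotProduct_smul, smul_smul, h1, smul_eq_mul,
      mul_one, star_alignPhase_mul_self]
  · rw [plaquettePair, mulVec_smul, hH, smul_comm]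

/-- The **`d`-wave overlap** `c(U) = ⟨2h| Δ_d^{(R)} |0h⟩ ∈ ℂ` of the two plaquette states (the
B₁g selection rule is `c(U) ≠ 0`; `|c|²` is the weight with which the boson condensate projects
onto the microscopic pair field `Δ_d`). Altman–Auerbach 2002, §II.D (`√Z'_b`, with
`1/3 < Z'_b < 2/3` reported for the relevant `U/t`). [cite: AltmanAuerbach2002, §II.D] -/
def plaquetteDWaveOverlap (U : ℝ) : ℂ :=
  star (plaquettePair U) ⬝ᵥ (plaquetteDWavePair *ᵥ plaquetteVacuum U)

/-- In the chosen gauge the `d`-wave overlap is the nonnegative real number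
`‖⟨raw 2h| Δ_d^{(R)} |0h⟩‖`. [folklore] -/
theorem plaquetteDWaveOverlap_eq (U : ℝ) :
    plaquetteDWaveOverlap U =
      ((‖star (plaquettePairRaw U) ⬝ᵥ (plaquetteDWavePair *ᵥ plaquetteVacuum U)‖ : ℝ) : ℂ) := by
  rw [plaquetteDWaveOverlap, plaquettePair, star_smul, smul_dotProduct, smul_eq_mul,
    star_alignPhase_mul]

/-- The two plaquette states of the low-energy manifold, indexed by the number of hole pairs
(bosons): `0 ↦ |0h⟩ = plaquetteVacuum U`, `1 ↦ |2h⟩ = plaquettePair U`.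
Yao–Tsai–Kivelson 2007, eq. (2). [cite: YaoTsaiKivelson2007, eq. (2)] -/
def plaquetteStates (U : ℝ) : Fin 2 → Fock (Orb PlaquetteSite) :=
  ![plaquetteVacuum U, plaquettePair U]

/-- Each plaquette state is normalised and is a ground state of its sector `(4 − 2k, 0)`.
[folklore] -/
theorem plaquetteStates_spec (U : ℝ) (k : Fin 2) :
    star (plaquetteStates U k) ⬝ᵥ plaquetteStates U k = 1 ∧
      IsGroundStateInSector (plaquetteHamiltonian U) (4 - 2 * (k : ℕ)) 0 (plaquetteStates U k) := by
  fin_cases k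
  · exact plaquetteVacuum_spec U
  · exact plaquettePair_spec U

/-- The sector energies `E(2k)` are the sector minima used by `IsGroundStateInSector`
(`SU(2)`: the `N`-particle ground energy is attained at `S^z = 0`). [folklore] -/
theorem plaquetteEnergy_two_mul (U : ℝ) (k : Fin 2) :
    plaquetteEnergy U (2 * (k : ℕ)) =
      (plaquetteHamiltonian U).minEnergyOn (szSector (4 - 2 * (k : ℕ)) 0) := by
  have h := fun n (hn : n ≤ Fintype.card PlaquetteSite) =>
    groundEnergyAt_eq_minEnergyOn_szSector plaquetteGraph 1 U hn
  fin_cases k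
  · simpa [plaquetteEnergy, plaquetteHamiltonian] using h 2 (by rw [card_plaquetteSite]; omega)
  · simpa [plaquetteEnergy, plaquetteHamiltonian] using h 1 (by rw [card_plaquetteSite]; omega)

/-- The plaquette states are eigenvectors with eigenvalues `E(0)` and `E(2)`:
`H |k⟩ = E(2k) |k⟩`. [folklore] -/
theorem plaquetteHamiltonian_mulVec_plaquetteStates (U : ℝ) (k : Fin 2) :
    plaquetteHamiltonian U *ᵥ plaquetteStates U k =
      ((plaquetteEnergy U (2 * (k : ℕ)) : ℝ) : ℂ) • plaquetteStates U k := by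
  rw [plaquetteEnergy_two_mul]
  exact (plaquetteStates_spec U k).2.2.2

/-- The unperturbed energy of the two-plaquette product state `|k⟩ ⊗ |k'⟩` entering the
second-order denominators is `E(2k) + E(2k')`. [folklore] -/
theorem pairEnergy_plaquetteStates (U : ℝ) (κ : Fin 2 × Fin 2) :
    pairEnergy (plaquetteHamiltonian U) (plaquetteStates U) κ =
      plaquetteEnergy U (2 * (κ.1 : ℕ)) + plaquetteEnergy U (2 * (κ.2 : ℕ)) := by
  have key : ∀ k : Fin 2, (expect (plaquetteHamiltonian U) (plaquetteStates U k)).re =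
      plaquetteEnergy U (2 * (k : ℕ)) := by
    intro k
    rw [expect, plaquetteHamiltonian_mulVec_plaquetteStates, dotProduct_smul,
      (plaquetteStates_spec U k).1, smul_eq_mul, mul_one, Complex.ofReal_re]
  rw [pairEnergy, key, key]

/-! ### The inter-plaquette bond and the second-order kernel -/

/-- The two `t'`-bonds joining a plaquette `R` (cluster 1) to its right neighbour `R' = R + 2e₁`
(cluster 2), as (site of `R`, site of `R'`) pairs in plaquette coordinates: the right column
`(1, y)` of `R` to the left column `(0, y)` of `R'`, `y = 0, 1`. Yao–Tsai–Kivelson 2007, Fig. 1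
(dashed bonds). [cite: YaoTsaiKivelson2007, Fig. 1] -/
def plaquetteBonds : Finset (PlaquetteSite × PlaquetteSite) :=
  {(toLex ![1, 0], toLex ![0, 0]), (toLex ![1, 1], toLex ![0, 1])}

/-- Adjacent plaquettes are joined by exactly two bonds. [folklore] -/
theorem card_plaquetteSiteBonds : plaquetteBonds.card = 2 := by
  decide

/-- **The second-order kernel of two adjacent plaquettes.** `plaquetteKernel U κ' κ` is the matrix
element `⟨κ'| T (E − H₀)⁻¹_red T |κ⟩` between the product states `|κ⟩ = |κ.1⟩_R ⊗ |κ.2⟩_{R'}`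
(`κ ∈ Fin 2 × Fin 2` = numbers of hole pairs on `R` and on `R' = R + 2e₁`), where `H₀` is the
decoupled pair of plaquette Hamiltonians, `T = −Σ_{(p,q) ∈ bonds, σ} (c†_{pσ} c_{qσ} + h.c.)` the
inter-plaquette hopping at `t' = 1`, `E = E(2κ.1) + E(2κ.2)` (`pairEnergy_plaquetteStates`; equal
for `κ`, `κ'` in the degenerate manifold) and the reduced resolvent runs over all products of
one-plaquette eigenstates (odd charge on each plaquette; terms at exact resonance are omitted,
Kato's convention) — the second-order term of `H_eff = PHP + PT(E₀ − H₀)⁻¹(1 − P)TP + …`,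
Tsai–Kivelson 2006, App. A (A1), evaluated by the one-cluster formula `interClusterKernel` (with
the inter-plaquette Jordan–Wigner sign). The physical couplings are `t'² ×` these numbers.
[cite: TsaiKivelson2006, App. A (A1)] -/
def plaquetteKernel (U : ℝ) (κ' κ : Fin 2 × Fin 2) : ℂ :=
  interClusterKernel (plaquetteHamiltonian_isHermitian U) (plaquetteStates U)
    (bondHopping plaquetteBonds) κ' κ

/-- The kernel is Hermitian, `conj K(κ', κ) = K(κ, κ')`; in particular its diagonal (the
second-order shifts `δE(κ)`) is real. [folklore] -/
theorem star_plaquetteKernel (U : ℝ) (κ' κ : Fin 2 × Fin 2) :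
    star (plaquetteKernel U κ' κ) = plaquetteKernel U κ κ' :=
  star_interClusterKernel _ _ _ κ' κ

/-- The diagonal second-order shifts are real numbers. [folklore] -/
theorem plaquetteKernel_diag_im (U : ℝ) (κ : Fin 2 × Fin 2) : (plaquetteKernel U κ κ).im = 0 := by
  have h := congrArg Complex.im (star_plaquetteKernel U κ κ)
  rw [Complex.star_def, Complex.conj_im] at h
  linarith

/-! ### The bundled couplings -/

/-- The `O(t'²)` effective couplings of the checkerboard Hubbard model on the manifold
{every plaquette in its `0`-hole or `2`-hole ground state} — the data of the hard-core boson model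
`H⁽¹⁾ = −t⁽¹⁾ Σ (b†_R b_{R'} + h.c.) + V⁽¹⁾ Σ ρ_R ρ_{R'}` of Yao–Tsai–Kivelson 2007, eq. (2),
together with the one-plaquette energies. All entries are functions of `U` alone (`t = 1`, `t'²`
factored out). [cite: YaoTsaiKivelson2007, eq. (2)] -/
structure PlaquettePairCouplings where
  /-- `E Q`: plaquette ground-state energy with `Q` holes (`plaquetteEnergy`). -/
  E : ℕ → ℝ
  /-- pair binding `2E(1) − E(0) − E(2)` (`> 0`: two holes bind on a plaquette). -/
  pairBinding : ℝ
  /-- pair exclusion `E(0) + E(4) − 2E(2)` (hard core). -/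
  pairExclusion : ℝ
  /-- pair (boson) hopping amplitude `J = t⁽¹⁾/t'²`: `H_eff ∋ −J t'² (b†_R b_{R'} + h.c.)`. -/
  J : ℝ
  /-- nearest-neighbour pair–pair interaction `V = V⁽¹⁾/t'²`: `H_eff ∋ V t'² ρ_R ρ_{R'}`. -/
  V : ℝ
  /-- `O(t'²)` one-body shift of a boson per superlattice bond. -/
  μ : ℝ
  /-- the `d`-wave overlap `⟨2h| Δ_d^{(R)} |0h⟩ ≥ 0` in the chosen gauge. -/
  c : ℝ

namespace PlaquettePairCouplings

/-- The **effective XXZ anisotropy** `Δ_eff = −V/(2J)`: `−J(b†b' + h.c.) + V ρρ' =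
2J · [−½ (b†b' + h.c.) + (V/2J) ρρ']`, and `xxzHamiltonian 1 G (−1) Δ = −Σ (SˣSˣ + SʸSʸ + Δ SᶻSᶻ)`
is hard-core bosons with hopping `½` and repulsion `−Δ`; the Heisenberg points `|Δ_eff| = 1` are
`V⁽¹⁾/t⁽¹⁾ = 2` (Yao–Tsai–Kivelson 2007, p. 4: at `U_s ≈ 2.7` and `U_c`). Junk value `0` if `J = 0`.
[cite: YaoTsaiKivelson2007, p. 4] -/
def ΔEff (C : PlaquettePairCouplings) : ℝ := -C.V / (2 * C.J)

end PlaquettePairCouplings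

/-- **`plaquettePairCouplings U`** — the `O(t'²)` pair-boson couplings of the checkerboard Hubbard
model at intra-plaquette `t = 1` and on-site `U`, from exact one-plaquette data and the
two-plaquette second-order kernel `K = plaquetteKernel U` (`κ = (n_R, n_{R'})` hole pairs):
* `E = plaquetteEnergy U`, `pairBinding = 2E(1) − E(0) − E(2)`,
  `pairExclusion = E(0) + E(4) − 2E(2)`;
* `J = −Re K((1,0),(0,1))`: the amplitude for the hole pair to hop `R' → R` (two electrons
  `R → R'` through the `(3e, 3e)` intermediate states), signed so that
  `H_eff ∋ −J t'² (b†_R b_{R'} + h.c.)` — `J = t⁽¹⁾` of Yao–Tsai–Kivelson 2007, eq. (2), so that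
  `J > 0` favours the UNIFORM condensate of the translation-covariantly gauged `d`-wave bosons
  (the same two states are used on both plaquettes, which makes `K((1,0),(0,1))` invariant under
  rephasing `|0h⟩`, `|2h⟩`: each enters once as bra and once as ket; for the real Hamiltonian it is
  a real number). SIGN CAVEAT: the matrix element itself is `K((1,0),(0,1)) =
  Σ_n ⟨1,0|T|n⟩⟨n|T|0,1⟩/(E − E_n) = −J`; e.g. for `s`-wave pairs bound by an attractive `−|U|`
  on two sites the same formula gives `K = −2t'²/|U|`, `J = +2t'²/|U|`;
* `V = Re [K(1,1) + K(0,0) − K(1,0) − K(0,1)]`: writing the diagonal shifts as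
  `δE(n,n') = δE(0,0) + μ n + μ' n' + V n n'` (`n, n' ∈ {0,1}`), the n.n. boson repulsion `V⁽¹⁾`
  of eq. (2); it equals `δE(1,1) + δE(0,0) − 2 δE(1,0)` when `δE(1,0) = δE(0,1)`
  (`plaquettePairCouplings_V_eq_of_symm`);
* `μ = Re [K(1,0) − K(0,0)]`: the `O(t'²)` one-body shift felt by a boson on `R` from this bond (on
  the checkerboard lattice a plaquette has four such bonds; at fixed boson number these are
  constants / on-site fields);
* `c = ‖⟨2h| Δ_d^{(R)} |0h⟩‖ = plaquetteDWaveOverlap U` (real `≥ 0` by the gauge choice).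
Intended use (KineticGlueInWindow): `0 < J`, `0 < V ≤ (2 − η) J`, `0 < pairBinding`, `c ≠ 0` on a
`U`-interval below `U_s ≈ 2.7`, by certified exact diagonalisation. Yao–Tsai–Kivelson 2007,
eq. (2) and p. 4; Tsai–Kivelson 2006, App. A. [cite: YaoTsaiKivelson2007, eq. (2)] -/
def plaquettePairCouplings (U : ℝ) : PlaquettePairCouplings where
  E := plaquetteEnergy U
  pairBinding := plaquettePairBinding U
  pairExclusion := plaquettePairExclusion U
  J := -(plaquetteKernel U (1, 0) (0, 1)).re
  V := (plaquetteKernel U (1, 1) (1, 1)).re + (plaquetteKernel U (0, 0) (0, 0)).re -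
    (plaquetteKernel U (1, 0) (1, 0)).re - (plaquetteKernel U (0, 1) (0, 1)).re
  μ := (plaquetteKernel U (1, 0) (1, 0)).re - (plaquetteKernel U (0, 0) (0, 0)).re
  c := ‖plaquetteDWaveOverlap U‖

/-- The overlap entry is the actual (complex) overlap of the two states used in the kernel:
`⟨2h| Δ_d^{(R)} |0h⟩ = c(U)`, a nonnegative real. [folklore] -/
theorem plaquetteDWaveOverlap_eq_c (U : ℝ) :
    plaquetteDWaveOverlap U = (((plaquettePairCouplings U).c : ℝ) : ℂ) := by
  simp only [plaquettePairCouplings]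
  rw [plaquetteDWaveOverlap_eq, Complex.norm_real, Real.norm_of_nonneg (norm_nonneg _)]

/-- `0 ≤ c(U)`. [folklore] -/
theorem plaquettePairCouplings_c_nonneg (U : ℝ) : 0 ≤ (plaquettePairCouplings U).c :=
  norm_nonneg _

/-- The pair-hopping entry written as a second-order matrix element with the sign of
Yao–Tsai–Kivelson 2007, eq. (2): `⟨1,0| T (E − H₀)⁻¹_red T |0,1⟩ = −J` (real part; the entry is
the `b†_R b_{R'}` coefficient of the effective Hamiltonian). [cite: YaoTsaiKivelson2007, eq. (2)] -/
theorem plaquetteKernel_hop_re (U : ℝ) :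
    (plaquetteKernel U (1, 0) (0, 1)).re = -(plaquettePairCouplings U).J := by
  simp [plaquettePairCouplings]

/-- For a reflection-symmetric bond (`δE(1,0) = δE(0,1)`, which holds here by the `y ↦ y`
reflection exchanging the two plaquettes once the states are nondegenerate) the interaction is the
requested combination `V = δE(1,1) + δE(0,0) − 2 δE(1,0)`. [folklore] -/
theorem plaquettePairCouplings_V_eq_of_symm (U : ℝ)
    (h : (plaquetteKernel U (1, 0) (1, 0)).re = (plaquetteKernel U (0, 1) (0, 1)).re) :
    (plaquettePairCouplings U).V =
      (plaquetteKernel U (1, 1) (1, 1)).re + (plaquetteKernel U (0, 0) (0, 0)).re -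
        2 * (plaquetteKernel U (1, 0) (1, 0)).re := by
  simp only [plaquettePairCouplings]
  rw [← h]
  ring

/-- The diagonal shifts decompose exactly into constant, one-body and two-body parts:
`Re K((n,n'),(n,n')) = Re K(0,0) + μ n + μ' n' + V n n'` for `n, n' ∈ {0,1}`, with
`μ' = Re [K(0,1) − K(0,0)]`. [folklore] -/
theorem plaquetteKernel_diag_decomposition (U : ℝ) :
    ∀ n n' : Fin 2, (plaquetteKernel U (n, n') (n, n')).re =
      (plaquetteKernel U (0, 0) (0, 0)).re + (plaquettePairCouplings U).μ * (n : ℕ) +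
        ((plaquetteKernel U (0, 1) (0, 1)).re - (plaquetteKernel U (0, 0) (0, 0)).re) * (n' : ℕ) +
          (plaquettePairCouplings U).V * ((n : ℕ) * (n' : ℕ)) := by
  simp only [Fin.forall_fin_two, Fin.isValue, Fin.val_zero, Fin.val_one, Nat.cast_zero,
    Nat.cast_one, plaquettePairCouplings]
  refine ⟨⟨?_, ?_⟩, ?_, ?_⟩ <;> ring

/-- `ΔEff` unfolded: `Δ_eff(U) = −V(U)/(2 J(U))`. [folklore] -/
theorem plaquettePairCouplings_ΔEff (U : ℝ) :
    (plaquettePairCouplings U).ΔEff =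
      -(plaquettePairCouplings U).V / (2 * (plaquettePairCouplings U).J) := rfl

end Literature.MathematicalPhysics.QuantumLattice
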